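import Literature.AlgebraicGeometry.Resolution.AlterationsNormalFormBlowupChartsFormalProofs
import Literature.AlgebraicGeometry.Resolution.AlterationsNormalFormCentreFormalIdealProofs
import HarnessLib

/-!
# De Jong 1996, 4.27: the chart description of the blow-up `X'` — discharged

Topic: `Literature/AlgebraicGeometry/Resolution`. Proofs file (discharges only) for two named
facts of the block 4.25–4.28 of de Jong 1996 (resolution of a pair in normal form by blowing up
the components of the codimension-three singular locus, pp. 75–76):

* `DeJong1996NormalFormPairBlowupChartsOverCentre_holds` — 4.27 [C2] at the closed points of
  `X'` over the centre `Ē` (`AlterationsNormalFormBlowupChartsReduction.lean`): "We blow up the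
  scheme `Spec k⟦u, v, t₁, …, t_{d-1}⟧/(uv - t₁ ⋯ t_s)` in the ideal `(u, v, t₁, t₂)`. We get four
  charts […] Chart "`u ≠ 0`" […] Clearly, this is smooth and `Z` is given by
  `u t₁' t₂' t₃ ⋯ t_r = 0`, a normal crossings divisor. Chart "`t₁ ≠ 0`" […] Clearly the
  singularities are of the type described in (ii)." It is the composition of the reduction
  `DeJong1996NormalFormPairBlowupChartsOverCentre.of_centreFormalIdeal_of_formalCharts`
  (`AlterationsNormalFormBlowupChartsFormal.lean`) with the two discharged inputs: the formal
  ideal of the centre (`DeJong1996NormalFormPairCentreFormalIdeal_holds`,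
  `AlterationsNormalFormCentreFormalIdealProofs.lean`) and the formal chart computation
  (`DeJong1996NodalBlowupFormalCharts_holds`, `AlterationsNormalFormBlowupChartsFormalProofs.lean`).
* `DeJong1996NormalFormPairBlowupCharts_holds` — 4.27 [C2] at all closed points of `X'`
  (`AlterationsNormalFormBlowupParts.lean`), from the previous discharge by
  `DeJong1996NormalFormPairBlowupCharts.of_overCentre` (off `π⁻¹(Ē)` the blow-up does not change
  the completed local rings).

No definitions, no new named facts; pure compositions of assemblies already in the tree.

## Sources

* A. J. de Jong, *Smoothness, semi-stability and alterations*, Publ. Math. IHÉS 83 (1996)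
  51–93: 4.25–4.27, pp. 75–76 (the chart computation: 4.27, p. 76). [DeJong1996]
-/

noncomputable section

open CategoryTheory AlgebraicGeometry

namespace Literature.AlgebraicGeometry.Resolution

universe u

/-- **De Jong 1996, 4.27 [C2] over the centre — DISCHARGE of
`DeJong1996NormalFormPairBlowupChartsOverCentre`**: at the closed points of the blow-up `X'`
over `Ē`, the completed local ring with the completed ideal of `π⁻¹(Z)` is
`(k⟦x₁, …, x_d⟧, (x₁ ⋯ x_r))` at regular points and
`(k⟦u, v, t₁, …, t_{d-1}⟧/(uv - t₁ ⋯ t_s), (t₁ ⋯ t_r))` at singular ones; from the formal ideal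
of the centre and the formal chart computation, both discharged.
[cite: DeJong1996, 4.27, p. 76] -/
theorem DeJong1996NormalFormPairBlowupChartsOverCentre_holds :
    DeJong1996NormalFormPairBlowupChartsOverCentre.{u} :=
  DeJong1996NormalFormPairBlowupChartsOverCentre.of_centreFormalIdeal_of_formalCharts
    DeJong1996NormalFormPairCentreFormalIdeal_holds DeJong1996NodalBlowupFormalCharts_holds

/-- **De Jong 1996, 4.27 [C2] at all closed points of `X'` — DISCHARGE of
`DeJong1996NormalFormPairBlowupCharts`**: `π⁻¹(Z)` is the support of an effective Cartier
divisor and the completed local rings of `X'` at its closed points, with the completed ideal of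
`π⁻¹(Z)`, have the shape 4.25 (i) (regular points) resp. 4.25 (ii) (singular points); off the
centre this is 4.25 for `(X, Z)` transported along the blow-up (an isomorphism there), over the
centre it is the previous discharge. [cite: DeJong1996, 4.27, pp. 75–76] -/
theorem DeJong1996NormalFormPairBlowupCharts_holds : DeJong1996NormalFormPairBlowupCharts.{u} :=
  DeJong1996NormalFormPairBlowupCharts.of_overCentre
    DeJong1996NormalFormPairBlowupChartsOverCentre_holds

end Literature.AlgebraicGeometry.Resolution

end
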